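import Literature.AlgebraicGeometry.Frobenioids.Thm49Assembly
import Literature.AlgebraicGeometry.Frobenioids.Thm49CompatOfFunctor
import Literature.AlgebraicGeometry.Frobenioids.BirationalNormalizationExampleRational
import Literature.AlgebraicGeometry.Frobenioids.BirationalNormalizationExampleIsFrobenioid
import Literature.AlgebraicGeometry.Frobenioids.BirationalNormalizationExampleNotBiratNormalized
import Literature.AlgebraicGeometry.Frobenioids.UnitTrivializationProp48iiiUnconditional
import Literature.AlgebraicGeometry.Frobenioids.GeometricDivisorPerfFactorial
import Literature.AlgebraicGeometry.Frobenioids.PadicFrobenioidQpSplit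
import Literature.AnabelianGeometry.EtaleTheta.Discharge.Sec3Remark364
import Mathlib.Algebra.Ring.Fin
import HarnessLib

/-!
# Frobenioids I, Theorem 4.9 at Example 4.6 — the closers exercised at a Frobenioid that is NOT of rationally
# standard type (non-vacuity row NV-L1; the conclusion `Ψ^Φ` beyond Def. 4.5 (iii)(a))

Mochizuki, *The geometry of Frobenioids I: the general theory*, Kyushu J. Math. **62** (2008) 293–400,
Theorem 4.9 p. 88 [cite: MochizukiFrdI2008, Thm. 4.9 p.88] and Example 4.6 pp. 86–87: "`C` is a Frobenioid of
isotropic and standard type which is not of group-like type … of [strictly] rational type … if the `ξ_p ≠ 0` …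
`C` fails to be of birationally Frobenius-normalized type" [cite: MochizukiFrdI2008, Ex. 4.6 pp.86-87].

PROOF-ONLY file (node FrdI:Thm4.9, genuine-data instance; seat abc-iut-w4-d109, T49-L00 lineage — the follow-up
named in its gen-2 HANDOFF), 0 definitions. The cell's Thm. 4.9 closers are instantiated at the Frobenioid `C` of
Ex. 4.6 (`Ex46.Obj P`, seat abc-iut-L1-t8: one-morphism base `D`, `Φ ≡ ℤ_{≥0} × ℤ_{≥0}`, datum `P` = the `ξ_p`):

* the one missing input — **`ℤ_{≥0} × ℤ_{≥0}` is perf-factorial** (`isPerfFactorial_nat_prod_nat`: seat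
  abc-iut-L1-d2's `ℤ_{≥0}[I]` perf-factorial, `isPerfFactorial_multiplicative_finsupp`, transported along
  `ℤ_{≥0}[Fin 2] ≅ ℤ_{≥0} × ℤ_{≥0}`);
* the other inputs are seat abc-iut-L1-t8's theorems: `Ex46.isFrobenioid`, `Ex46.isRational` (every object
  rational at THE birationalization, here at the primary support — the closers' binder `hrat₁`),
  `Ex46.isOfStandardType`, `Ex46.isOfIsotropicType`, `Ex46.not_isOfType_isGroupLikeObj`; the one-morphism base is
  of FSM-type (`PadicFrd.isOfFSMType_discretePUnit`, seat abc-iut-L1-t4).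

RESULTS, for every pair of data `P₁, P₂` and EVERY equivalence `Ψ : C(P₁) ⥲ C(P₂)`:
* `Ex46.thm49_ex46_rsParams` — the typed `Thm49` (any parameters);
* `Ex46.exists_thm49_compat_ex46`, **`Ex46.nonempty_divisorMonoidIsoOver_ex46`** — the compatibility closer needs
  only the `Thm42Setting` (standard, isotropic, not group-like), all TRUE here, so an isomorphism of functors
  `Ψ^Φ : Φ₁ ⥲ Φ₂` lying over `Ψ` (with the `Ψ^Prime`-compatibility) EXISTS with no hypothesis;
* `Ex46.not_isOfRationallyStandardType_rsParams` — whereas for a datum with some `ξ_p ≠ 0` (`Ξ(n) ≠ 0`) the typed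
  ANTECEDENT of Thm. 4.9 FAILS at THE parameters: `C` is not of rationally standard type (Def. 4.5 (iii)(a):
  not birationally Frobenius-normalized, seat abc-iut-L1-t8's `Ex46.not_isBiratFrobeniusNormalized_A₀`).
So at Ex. 4.6 the typed `Thm49` holds with a refuted antecedent while its CONCLUSION is nevertheless a theorem
(`Ex46.thm49_conclusion_beyond_hypothesis`): an honest record that the cell's construction of `Ψ^Φ` (Thm. 4.2
(iii) + descent) uses "standard, isotropic, not group-like, rational, perf-factorial, FSM base" and not clause
(a)'s birational Frobenius-normalization. No statement of the paper is restated or strengthened; nothing here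
bears on, or takes a side on, [IUTchIII] Cor. 3.12.
-/

noncomputable section

namespace Literature.AlgebraicGeometry.Frobenioids

open CategoryTheory Opposite
open PreFrobenioid PreFrobenioidData

namespace Ex46

/-! ### `ℤ_{≥0} × ℤ_{≥0}` is perf-factorial -/

/-- **`ℤ_{≥0} × ℤ_{≥0}` (written multiplicatively) is perf-factorial** (Def. 2.4 (i)): `ℤ_{≥0}[Fin 2]` is
(seat abc-iut-L1-d2 lineage, `isPerfFactorial_multiplicative_finsupp`) and Def. 2.4 (i) is invariant under the
monoid isomorphism `ℤ_{≥0}[Fin 2] ≅ ℤ_{≥0}^{Fin 2} ≅ ℤ_{≥0} × ℤ_{≥0}` (`isPerfFactorial_of_mulEquiv`).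
[cite: MochizukiFrdI2008, Def. 2.4 (i) p.47] -/
theorem isPerfFactorial_nat_prod_nat : IsPerfFactorial (Multiplicative (ℕ × ℕ)) :=
  Literature.AnabelianGeometry.EtaleTheta.isPerfFactorial_of_mulEquiv
    (AddEquiv.toMultiplicative
      ((Finsupp.addEquivFunOnFinite (ι := Fin 2) (M := ℕ)).trans
        (RingEquiv.piFinTwo fun _ : Fin 2 => ℕ).toAddEquiv))
    (isPerfFactorial_multiplicative_finsupp (Fin 2))

/-- `Φ ≡ ℤ_{≥0} × ℤ_{≥0}` on the one-morphism base is perf-factorial objectwise (the form the Thm. 4.9 closers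
consume). [cite: MochizukiFrdI2008, Ex. 4.6 p.87] -/
theorem objectwise_isPerfFactorial_Φ :
    Objectwise (fun M _ => IsPerfFactorial M) Literature.AlgebraicGeometry.Frobenioids.Ex46.Φ :=
  fun _ => isPerfFactorial_nat_prod_nat

section TwoData

variable {G₁ : Type} [AddCommGroup G₁] {G₂ : Type} [AddCommGroup G₂] (P₁ : Datum G₁) (P₂ : Datum G₂)

/-! ### The hypotheses of the Thm. 4.9 closers at Ex. 4.6 -/

/-- **"`C` is of [strictly] rational type"** (Ex. 4.6 p. 87) READ AT THE CONSTRUCTIONS — the binder `hrat₁` of the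
closers: every object is rational at THE birationalization and the primary support of Def. 2.4 (i)(d) (seat
abc-iut-L1-t8's `Ex46.isRational`, whose support parameter is here THE primary support, `Iff.rfl`).
[cite: MochizukiFrdI2008, Ex. 4.6 p.87] -/
theorem isRational_biratData_primarySupp (A : Obj P₁) :
    PreFrobenioidData.IsRational
      (biratData (isFrobenioid P₁) (hasBiratSquares_of_isFrobenioid (isFrobenioid P₁)))
      (S := ofFunctor Literature.AlgebraicGeometry.Frobenioids.Ex46.Φ (toElem P₁)) (fun a 𝔭 => PrimarySupp a 𝔭) A :=
  isRational P₁ (isFrobenioid P₁) (hasBiratSquares_of_isFrobenioid (isFrobenioid P₁)) (fun a 𝔭 => PrimarySupp a 𝔭)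
    (fun _ _ _ => Iff.rfl) A

/-- `C` is not of group-like type, in the operations language ("which is not of group-like type", Ex. 4.6 p. 87).
[cite: MochizukiFrdI2008, Ex. 4.6 p.87] -/
theorem not_isOfGroupLikeType :
    ¬ (ofFunctor Literature.AlgebraicGeometry.Frobenioids.Ex46.Φ (toElem P₁)).IsOfGroupLikeType := fun h =>
  not_isOfType_isGroupLikeObj P₁ fun A => (ofFunctor_isGroupLikeObj (toElem P₁) A).mp (h.obj A)

/-- The `Thm42Setting` (standard type, isotropic type, not of group-like type) HOLDS for every pair of Ex. 4.6
Frobenioids ("a Frobenioid of isotropic and standard type which is not of group-like type", p. 87).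
[cite: MochizukiFrdI2008, Ex. 4.6 p.87] -/
theorem thm42Setting_ex46 :
    Thm42Setting (ofFunctor Literature.AlgebraicGeometry.Frobenioids.Ex46.Φ (toElem P₁))
      (ofFunctor Literature.AlgebraicGeometry.Frobenioids.Ex46.Φ (toElem P₂)) where
  standard := ⟨isOfStandardType P₁, isOfStandardType P₂⟩
  isotropic := ⟨(ofFunctor_isOfIsotropicType _).mpr (isOfIsotropicType P₁),
    (ofFunctor_isOfIsotropicType _).mpr (isOfIsotropicType P₂)⟩
  notGroupLike := ⟨not_isOfGroupLikeType P₁, not_isOfGroupLikeType P₂⟩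

/-! ### Theorem 4.9 at Ex. 4.6 -/

/-- **[FrdI] Thm. 4.9 AS TYPED (`PreFrobenioidData.Thm49`) for two Ex. 4.6 Frobenioids, any equivalence `Ψ`, ANY
parameters** — every closer input discharged (Frobenioid, one-morphism base of FSM-type, `Φ` perf-factorial,
rational at THE constructions). [cite: MochizukiFrdI2008, Thm. 4.9 p.88] -/
theorem thm49_ex46_rsParams (Ψ : Obj P₁ ≌ Obj P₂)
    (R₁ : (ofFunctor Literature.AlgebraicGeometry.Frobenioids.Ex46.Φ (toElem P₁)).RSParams)
    (R₂ : (ofFunctor Literature.AlgebraicGeometry.Frobenioids.Ex46.Φ (toElem P₂)).RSParams) :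
    (ofFunctor Literature.AlgebraicGeometry.Frobenioids.Ex46.Φ (toElem P₁)).Thm49
      (ofFunctor Literature.AlgebraicGeometry.Frobenioids.Ex46.Φ (toElem P₂)) Ψ R₁ R₂ :=
  FrdI.T49.thm49_ofFunctor_of_isOfFSMType (isFrobenioid P₁) (isFrobenioid P₂) PadicFrd.isOfFSMType_discretePUnit
    PadicFrd.isOfFSMType_discretePUnit objectwise_isPerfFactorial_Φ objectwise_isPerfFactorial_Φ
    (isRational_biratData_primarySupp P₁) Ψ R₁ R₂

/-- **The compatibility closer of Thm. 4.9 at Ex. 4.6, no hypothesis**: for every `Ψ : C(P₁) ⥲ C(P₂)` there are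
an isomorphism of functors `Ψ^Φ : Φ₁ ⥲ Φ₂` lying over `Ψ` computing `Div(Ψ φ) = Ψ^Φ(Div φ)` on pre-steps and THE
`Ψ^Prime` with the typed `Thm49_compat` — the `Thm42Setting` being TRUE at Ex. 4.6.
[cite: MochizukiFrdI2008, Thm. 4.9 p.89] -/
theorem exists_thm49_compat_ex46 (Ψ : Obj P₁ ≌ Obj P₂) :
    ∃ (E : DivisorMonoidIsoOver (ofFunctor Literature.AlgebraicGeometry.Frobenioids.Ex46.Φ (toElem P₁))
        (ofFunctor Literature.AlgebraicGeometry.Frobenioids.Ex46.Φ (toElem P₂)) Ψ)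
      (e : ∀ A : Obj P₁,
        Primes ((ofFunctor Literature.AlgebraicGeometry.Frobenioids.Ex46.Φ (toElem P₁)).Mon
            ((ofFunctor Literature.AlgebraicGeometry.Frobenioids.Ex46.Φ (toElem P₁)).base.obj A)) ≃
          Primes ((ofFunctor Literature.AlgebraicGeometry.Frobenioids.Ex46.Φ (toElem P₂)).Mon
            ((ofFunctor Literature.AlgebraicGeometry.Frobenioids.Ex46.Φ (toElem P₂)).base.obj (Ψ.functor.obj A)))),
      (∀ ⦃A B : Obj P₁⦄ (φ : A ⟶ B), IsPreStep (toElem P₁) φ →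
          E.iso A (Div (toElem P₁) φ) = Div (toElem P₂) (Ψ.functor.map φ)) ∧
      (ofFunctor Literature.AlgebraicGeometry.Frobenioids.Ex46.Φ (toElem P₁)).Thm49_compat
        (ofFunctor Literature.AlgebraicGeometry.Frobenioids.Ex46.Φ (toElem P₂)) Ψ E e := by
  obtain ⟨E, e, -, hdiv, h⟩ := FrdI.T49.exists_thm49_compat_ofFunctor_of_isOfFSMType' (isFrobenioid P₁)
    (isFrobenioid P₂) PadicFrd.isOfFSMType_discretePUnit PadicFrd.isOfFSMType_discretePUnit
    objectwise_isPerfFactorial_Φ objectwise_isPerfFactorial_Φ (isRational_biratData_primarySupp P₁) Ψ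
    (thm42Setting_ex46 P₁ P₂)
  exact ⟨E, e, hdiv, h⟩

/-- **The CONCLUSION of Thm. 4.9 at Ex. 4.6, no hypothesis**: for every `Ψ : C(P₁) ⥲ C(P₂)` there is an
isomorphism of functors `Ψ^Φ : Φ₁ ⥲ Φ₂` lying over `Ψ`. [cite: MochizukiFrdI2008, Thm. 4.9 p.88] -/
theorem nonempty_divisorMonoidIsoOver_ex46 (Ψ : Obj P₁ ≌ Obj P₂) :
    Nonempty (DivisorMonoidIsoOver (ofFunctor Literature.AlgebraicGeometry.Frobenioids.Ex46.Φ (toElem P₁))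
      (ofFunctor Literature.AlgebraicGeometry.Frobenioids.Ex46.Φ (toElem P₂)) Ψ) := by
  obtain ⟨E, -, -, -⟩ := exists_thm49_compat_ex46 P₁ P₂ Ψ
  exact ⟨E⟩

/-! ### … while the typed antecedent of Thm. 4.9 FAILS at Ex. 4.6 with some `ξ_p ≠ 0` -/

/-- **If some `Ξ(n) ≠ 0` (e.g. some `ξ_p ≠ 0`), `C` is NOT of rationally standard type at THE Def. 4.5 (iii)
parameters** (whatever the support predicate): clause (a) "birationally Frobenius-normalized type" fails at
the Frobenius-trivial object `A₀` (Ex. 4.6 p. 87: "`C` fails to be of birationally Frobenius-normalized type";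
seat abc-iut-L1-t8's `Ex46.not_isBiratFrobeniusNormalized_A₀`). So the typed `Thm49` at these parameters holds
with a REFUTED antecedent. [cite: MochizukiFrdI2008, Ex. 4.6 p.87] -/
theorem not_isOfRationallyStandardType_rsParams {n : ℕ+} (hn : P₁.Ξ n ≠ 0)
    (Supp : ∀ {X : Discrete PUnit.{1}}, (ofFunctor Literature.AlgebraicGeometry.Frobenioids.Ex46.Φ (toElem P₁)).Mon X →
      Primes ((ofFunctor Literature.AlgebraicGeometry.Frobenioids.Ex46.Φ (toElem P₁)).Mon X) → Prop) :
    ¬ (ofFunctor Literature.AlgebraicGeometry.Frobenioids.Ex46.Φ (toElem P₁)).IsOfRationallyStandardType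
        (rsParams (isFrobenioid P₁) Supp) := fun h =>
  not_isBiratFrobeniusNormalized_A₀ P₁ hn
    (Birat.isBiratFrobeniusNormalized_of_obj (isFrobenioid P₁)
      (hasBiratSquares_of_isFrobenioid (isFrobenioid P₁)) (A₀ P₁) (h.biratFrobNormalized.obj (A₀ P₁)))

/-- **Thm. 4.9's conclusion holds at Ex. 4.6 beyond its typed hypothesis**: for a datum `P₁` with some
`Ξ(n) ≠ 0`, `C(P₁)` is not of rationally standard type at THE parameters, yet for every `Ψ : C(P₁) ⥲ C(P₂)` the
isomorphism of functors `Ψ^Φ` lying over `Ψ` exists. [cite: MochizukiFrdI2008, Ex. 4.6 p.87] -/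
theorem thm49_conclusion_beyond_hypothesis {n : ℕ+} (hn : P₁.Ξ n ≠ 0) (Ψ : Obj P₁ ≌ Obj P₂) :
    ¬ (ofFunctor Literature.AlgebraicGeometry.Frobenioids.Ex46.Φ (toElem P₁)).IsOfRationallyStandardType
        (rsParams (isFrobenioid P₁) fun a 𝔭 => PrimarySupp a 𝔭) ∧
      Nonempty (DivisorMonoidIsoOver (ofFunctor Literature.AlgebraicGeometry.Frobenioids.Ex46.Φ (toElem P₁))
        (ofFunctor Literature.AlgebraicGeometry.Frobenioids.Ex46.Φ (toElem P₂)) Ψ) :=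
  ⟨not_isOfRationallyStandardType_rsParams P₁ hn _, nonempty_divisorMonoidIsoOver_ex46 P₁ P₂ Ψ⟩

end TwoData

end Ex46

end Literature.AlgebraicGeometry.Frobenioids

end
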